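import Literature.MathematicalPhysics.QuantumFieldTheory.ConformalBootstrap3D.HRCoeffTM
import Mathlib.Tactic.Linarith
import Mathlib.Tactic.Positivity
import Mathlib.Tactic.Ring
import HarnessLib

/-!
# The TABLE layer of a derivative certificate, XXIII: one Taylor-model recursion entry with INTERVAL quadratic numerators
(cell `pub-ising3x`, seat boot-1 gen 8; gate (g2) — first half of the Taylor models of the Dolan–Osborn array `A_{n,j}(a,b;Δ,ℓ)`
for the ODD head layer)

HONEST FRAMING: lottery ticket; floor = tightest certified 3D Ising CFT bounds; no exact-solution
claim without a proof. Island framing: certified exclusion region at stated derivative order and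
assumptions; not a determination of the 3D Ising critical exponents beyond that.

The Literature file `HRCoeffTM` builds Taylor models in `ρ` (`Δ = A + ρ`, `|ρ| ≤ 2^{-e}`) of the equal-dimension coefficients
`A_{n,j}(Δ,ℓ)`: one recursion entry `A_{n+1,j} = (γ⁺ A_{n,j-1} + γ⁻ A_{n,j+1}) / (p₀ + p₁ρ)` is the Taylor model
`HRTM.entryTM` — numerators `c⁺(a+ρ)²`, `c⁻(b+ρ)²` with EXACT rational `a, c⁺, b, c⁻`, synthetic division by the linear pivot,
remainder folded into the constant coefficient (`HRTM.tmem_entry`). For the odd sector of the mixed σ–ε system the coefficients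
are the Dolan–Osborn array `hrCoeffAB a b Δ ℓ n j` with `(a, b) = (∓t/2, ±t/2)`, `t = Δσ − Δε` ranging over the certificate's BOX:
the recursion weights `γ^±_{E,j}(a,b) = c^± (E ± … + 2a)(E ± … + 2b)` (MixedBlockCoefficients) are then quadratics in `ρ` with
INTERVAL coefficients. This file is the corresponding generic entry: `conv3I` (interval quadratic × interval polynomial,
`mem_conv3I`, `sum_conv3RR`), **`entryTMI`** and **`tmem_entryI`** — verbatim `HRTM.tmem_entry` with the numerator memberships
and the numerator identity generalised to real quadratic coefficients `g₀ + g₁ρ + g₂ρ²` lying in given intervals; the pivot,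
the synthetic division (`HRTM.bList`, `HRTM.sd_identity`) and the remainder bound are unchanged. The rows of the REGULARISED
array `(Δ − b_ℓ)·A_{n,j}(a,b;Δ,ℓ)` built from it are the next file (`TaylorTableOddCoeffTM`).
Sources: Dolan–Osborn 2004 §3 eqs. (3.11)–(3.12); Hogervorst–Rychkov 2013 §3; Makino–Berz Taylor models. Elementary. [folklore]
-/

namespace Summit.CriticalPhenomena.Ising3D

open Finset
open Literature.Analysis.ValidatedNumerics Literature.Analysis.ValidatedNumerics.PolyMP
open Literature.Analysis.ValidatedNumerics.NumericsMP
open Literature.MathematicalPhysics.QuantumFieldTheory.ConformalBootstrap3D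
open Literature.MathematicalPhysics.QuantumFieldTheory.ConformalBootstrap3D.HRTM
open Literature.MathematicalPhysics.QuantumFieldTheory.ConformalBootstrap3D.PointKernel (mulQ mem_mulQ)

namespace HRTMI

/-! ### A. Interval quadratic × interval polynomial -/

/-- Coefficient `k` of `(g₀ + g₁ρ + g₂ρ²)·P(ρ)` for an INTERVAL quadratic (scale `S`). [folklore] -/
def conv3I (S : ℕ) (G0 G1 G2 : MI) (P : IPoly) (k : ℕ) : MI :=
  let t0 := MI.mul S (cf P k) G0
  let t1 := if 1 ≤ k then MI.add t0 (MI.mul S (cf P (k - 1)) G1) else t0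
  if 2 ≤ k then MI.add t1 (MI.mul S (cf P (k - 2)) G2) else t1

/-- Real shadow of `conv3I` (real coefficients `g₀, g₁, g₂`). [folklore] -/
noncomputable def conv3RR (g0 g1 g2 : ℝ) (as : List ℝ) (k : ℕ) : ℝ :=
  as.getD k 0 * g0 + (if 1 ≤ k then as.getD (k - 1) 0 * g1 else 0) +
    (if 2 ≤ k then as.getD (k - 2) 0 * g2 else 0)

/-- [folklore] -/
theorem mem_conv3I {S : ℕ} (hS : 0 < S) {as : List ℝ} {P : IPoly} (h : PMem S as P) {g0 g1 g2 : ℝ}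
    {G0 G1 G2 : MI} (h0 : MI.mem S g0 G0) (h1 : MI.mem S g1 G1) (h2 : MI.mem S g2 G2) (k : ℕ) :
    MI.mem S (conv3RR g0 g1 g2 as k) (conv3I S G0 G1 G2 P k) := by
  unfold conv3I conv3RR
  by_cases hk1 : 1 ≤ k
  · by_cases hk2 : 2 ≤ k
    · simp only [hk1, hk2, if_true]
      exact MI.mem_add (MI.mem_add (MI.mem_mul hS (mem_cf h k) h0) (MI.mem_mul hS (mem_cf h _) h1))
        (MI.mem_mul hS (mem_cf h _) h2)
    · simp only [hk1, hk2, if_true, if_false, add_zero]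
      exact MI.mem_add (MI.mem_mul hS (mem_cf h k) h0) (MI.mem_mul hS (mem_cf h _) h1)
  · have hk2 : ¬ 2 ≤ k := by omega
    simp only [hk1, hk2, if_false, add_zero]
    exact MI.mem_mul hS (mem_cf h k) h0

/-- The quadratic convolution evaluates to the product (real coefficients). [folklore] -/
theorem sum_conv3RR (g0 g1 g2 : ℝ) (as : List ℝ) (ρ : ℝ) {K : ℕ} (hK : as.length + 2 ≤ K) :
    ∑ k ∈ range K, conv3RR g0 g1 g2 as k * ρ ^ k = (g0 + g1 * ρ + g2 * ρ ^ 2) * evalR as ρ := by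
  obtain ⟨K₂, rfl⟩ : ∃ K₂, K = K₂ + 2 := ⟨K - 2, by omega⟩
  have e0 : ∑ k ∈ range (K₂ + 2), as.getD k 0 * g0 * ρ ^ k = g0 * evalR as ρ := by
    rw [← sum_getD_eq_evalR ρ as (K₂ + 2) (by omega), mul_sum]
    exact sum_congr rfl fun k _ => by ring
  have e1 : ∑ k ∈ range (K₂ + 2), (if 1 ≤ k then as.getD (k - 1) 0 * g1 else 0) * ρ ^ k =
      g1 * ρ * evalR as ρ := by
    rw [sum_shift1 (fun i => as.getD i 0 * g1) ρ (K₂ + 1),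
      ← sum_getD_eq_evalR ρ as (K₂ + 1) (by omega), mul_sum, mul_sum]
    exact sum_congr rfl fun k _ => by ring
  have e2 : ∑ k ∈ range (K₂ + 2), (if 2 ≤ k then as.getD (k - 2) 0 * g2 else 0) * ρ ^ k =
      g2 * ρ ^ 2 * evalR as ρ := by
    rw [sum_shift2 (fun i => as.getD i 0 * g2) ρ K₂,
      ← sum_getD_eq_evalR ρ as K₂ (by omega), mul_sum, mul_sum]
    exact sum_congr rfl fun k _ => by ring
  simp only [conv3RR, add_mul, sum_add_distrib, e0, e1, e2]

/-! ### B. One recursion entry with interval quadratic numerators -/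

/-- The Taylor model of one entry `f` with `(p₀ + p₁ρ) f = (g₀⁺ + g₁⁺ρ + g₂⁺ρ²) f⁺ + (g₀⁻ + g₁⁻ρ + g₂⁻ρ²) f⁻` from the models
`Pp ∋ f⁺`, `Pm ∋ f⁻` and INTERVALS `G·` containing the six real numerator coefficients: numerator coefficients by `conv3I`,
synthetic division by `p₀ + p₁ρ` to degree `D` (`HRTM.bList`), remainder folded into `b₀` exactly as `HRTM.entryTM`. [folklore] -/
def entryTMI (S e D : ℕ) (G0p G1p G2p G0m G1m G2m : MI) (p0 p1 : ℚ) (Pp Pm : IPoly) : IPoly :=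
  let num : ℕ → MI := fun k => MI.add (conv3I S G0p G1p G2p Pp k) (conv3I S G0m G1m G2m Pm k)
  let bs := bList num p0 p1 D
  let bD := bs.headD zI
  let r1 : ℤ := absHiI (MI.sub (num (D + 1)) (mulQ bD p1))
  let r2 : ℤ := absHiI (num (D + 2))
  let rn : ℤ := r1 / (2 ^ (e * (D + 1)) : ℤ) + r2 / (2 ^ (e * (D + 2)) : ℤ) + 2
  let m : ℚ := |p0| - |p1| / (2 ^ e : ℚ)
  let rem : ℤ := ⌈(rn : ℚ) / m⌉
  widen0 bs.reverse rem

/-- [folklore] -/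
theorem length_entryTMI (S e D : ℕ) (G0p G1p G2p G0m G1m G2m : MI) (p0 p1 : ℚ) (Pp Pm : IPoly) :
    (entryTMI S e D G0p G1p G2p G0m G1m G2m p0 p1 Pp Pm).length = D + 1 := by
  simp only [entryTMI]
  exact length_widen0_of_length (by rw [reverse_bList]; simp) _

/-- **One recursion entry, interval numerators.** If `P⁺ ∋ f⁺`, `P⁻ ∋ f⁻` (degree ≤ `D`) on `|ρ| ≤ 2^{-e}`, the six real
numerator coefficients lie in the given intervals, the pivot margin is positive and
`(p₀ + p₁ρ) f(ρ) = (g₀⁺ + g₁⁺ρ + g₂⁺ρ²) f⁺(ρ) + (g₀⁻ + g₁⁻ρ + g₂⁻ρ²) f⁻(ρ)` on the cell, then `entryTMI ∋ f`.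
(Proof = `HRTM.tmem_entry` with `mem_conv3I` / `sum_conv3RR`.) [folklore] -/
theorem tmem_entryI {S e D : ℕ} (hS : 0 < S) {G0p G1p G2p G0m G1m G2m : MI} {g0p g1p g2p g0m g1m g2m : ℝ}
    (hg0p : MI.mem S g0p G0p) (hg1p : MI.mem S g1p G1p) (hg2p : MI.mem S g2p G2p)
    (hg0m : MI.mem S g0m G0m) (hg1m : MI.mem S g1m G1m) (hg2m : MI.mem S g2m G2m)
    {p0 p1 : ℚ} {Pp Pm : IPoly} {fp fm f : ℝ → ℝ}
    (hPp : TMem S ((1 : ℚ) / 2 ^ e) fp Pp) (hPm : TMem S ((1 : ℚ) / 2 ^ e) fm Pm)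
    (hlp : Pp.length ≤ D + 1) (hlm : Pm.length ≤ D + 1) (hm : 0 < pivMargin e p0 p1)
    (hrec : ∀ ρ : ℝ, |ρ| ≤ (((1 : ℚ) / 2 ^ e : ℚ) : ℝ) →
      ((p0 : ℝ) + p1 * ρ) * f ρ = (g0p + g1p * ρ + g2p * ρ ^ 2) * fp ρ + (g0m + g1m * ρ + g2m * ρ ^ 2) * fm ρ) :
    TMem S ((1 : ℚ) / 2 ^ e) f (entryTMI S e D G0p G1p G2p G0m G1m G2m p0 p1 Pp Pm) := by
  intro ρ hρ
  obtain ⟨asp, hasp, efp⟩ := hPp ρ hρ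
  obtain ⟨asm, hasm, efm⟩ := hPm ρ hρ
  have hh : ((((1 : ℚ) / 2 ^ e : ℚ)) : ℝ) = 1 / 2 ^ e := by push_cast; ring
  rw [hh] at hρ
  have h0 : (0 : ℝ) ≤ 1 / 2 ^ e := by positivity
  -- the numerator coefficients and their enclosures
  set num : ℕ → MI := fun k => MI.add (conv3I S G0p G1p G2p Pp k) (conv3I S G0m G1m G2m Pm k) with hnum
  let ν : ℕ → ℝ := fun k => conv3RR g0p g1p g2p asp k + conv3RR g0m g1m g2m asm k
  have hν : ∀ k, MI.mem S (ν k) (num k) := fun k =>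
    MI.mem_add (mem_conv3I hS hasp hg0p hg1p hg2p k) (mem_conv3I hS hasm hg0m hg1m hg2m k)
  have hlenp : asp.length ≤ D + 1 := hasp.length_eq ▸ hlp
  have hlenm : asm.length ≤ D + 1 := hasm.length_eq ▸ hlm
  -- the numerator polynomial is `pivot · f`
  have hN : ∑ k ∈ range (D + 3), ν k * ρ ^ k = ((p0 : ℝ) + p1 * ρ) * f ρ := by
    have e1 := sum_conv3RR g0p g1p g2p asp ρ (K := D + 3) (by omega)
    have e2 := sum_conv3RR g0m g1m g2m asm ρ (K := D + 3) (by omega)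
    rw [hrec ρ (by rw [hh]; exact hρ), efp, efm]
    simp only [ν, add_mul, sum_add_distrib, e1, e2]
  -- pivot bounds
  have hmR : (0 : ℝ) < |(p0 : ℝ)| - |(p1 : ℝ)| / 2 ^ e := by
    have : ((pivMargin e p0 p1 : ℚ) : ℝ) = |(p0 : ℝ)| - |(p1 : ℝ)| / 2 ^ e := by
      simp only [pivMargin]; push_cast; ring
    rw [← this]; exact_mod_cast hm
  have hp0 : (p0 : ℝ) ≠ 0 := by
    intro h; rw [h, abs_zero] at hmR
    have : (0 : ℝ) ≤ |(p1 : ℝ)| / 2 ^ e := by positivity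
    linarith
  have hpiv : |(p0 : ℝ)| - |(p1 : ℝ)| / 2 ^ e ≤ |(p0 : ℝ) + p1 * ρ| := pivMargin_le_abs p0 p1 hρ
  -- synthetic division
  have hsd := sd_identity ν (p1 : ℝ) ρ hp0 D
  set B : ℝ := ∑ k ∈ range (D + 1), bR ν p0 p1 k * ρ ^ k with hB
  set δ : ℝ := f ρ - B with hδdef
  have hT : ((p0 : ℝ) + p1 * ρ) * δ =
      ρ ^ (D + 1) * ((ν (D + 1) - p1 * bR ν p0 p1 D) + ν (D + 2) * ρ) := by
    have e3 : ∑ k ∈ range (D + 3), ν k * ρ ^ k =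
        ∑ k ∈ range (D + 1), ν k * ρ ^ k + ν (D + 1) * ρ ^ (D + 1) + ν (D + 2) * ρ ^ (D + 2) := by
      rw [show D + 3 = D + 1 + 1 + 1 by omega, sum_range_succ, sum_range_succ]
    rw [hδdef, mul_sub, ← hN, e3, hsd]; ring
  -- scaled remainder bounds
  have hbD : MI.mem S (bR ν p0 p1 D) ((bList num p0 p1 D).headD zI) := by
    rw [headD_bList]; exact mem_bI hν p0 p1 D
  have hr1 := MI.abs_le_absHi (MI.mem_sub (hν (D + 1)) (mem_mulQ hbD p1))
  have hr2 := MI.abs_le_absHi (hν (D + 2))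
  set r1 : ℤ := (MI.sub (num (D + 1)) (mulQ ((bList num p0 p1 D).headD zI) p1)).absHi with hr1def
  set r2 : ℤ := (num (D + 2)).absHi with hr2def
  have hr1nn : (0 : ℝ) ≤ r1 := by exact_mod_cast absHi_nonneg _
  have hr2nn : (0 : ℝ) ≤ r2 := by exact_mod_cast absHi_nonneg _
  have hS0 : (0 : ℝ) ≤ S := by positivity
  -- |δ|·S·m ≤ r1 h^{D+1} + r2 h^{D+2}
  have hkey : |δ| * S * (|(p0 : ℝ)| - |(p1 : ℝ)| / 2 ^ e) ≤
      r1 * (1 / 2 ^ e) ^ (D + 1) + r2 * (1 / 2 ^ e) ^ (D + 2) := by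
    have h1 : |δ| * (|(p0 : ℝ)| - |(p1 : ℝ)| / 2 ^ e) ≤ |δ| * |(p0 : ℝ) + p1 * ρ| :=
      mul_le_mul_of_nonneg_left hpiv (abs_nonneg _)
    have h2 : |δ| * |(p0 : ℝ) + p1 * ρ| =
        |ρ| ^ (D + 1) * |(ν (D + 1) - p1 * bR ν p0 p1 D) + ν (D + 2) * ρ| := by
      rw [← abs_mul, mul_comm, hT, abs_mul, abs_pow]
    have h3 : |ρ| ^ (D + 1) ≤ (1 / 2 ^ e) ^ (D + 1) := pow_le_pow_left₀ (abs_nonneg _) hρ _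
    have h4 : |(ν (D + 1) - p1 * bR ν p0 p1 D) + ν (D + 2) * ρ| * S ≤ r1 + r2 * (1 / 2 ^ e) := by
      have h41 : |(ν (D + 1) - p1 * bR ν p0 p1 D) + ν (D + 2) * ρ| ≤
          |ν (D + 1) - bR ν p0 p1 D * p1| + |ν (D + 2)| * |ρ| := by
        rw [← abs_mul, mul_comm (p1 : ℝ)]; exact abs_add_le _ _
      have h42 : |ν (D + 2)| * |ρ| * S ≤ r2 * (1 / 2 ^ e) := by
        have := mul_le_mul hr2 hρ (abs_nonneg _) hr2nn
        calc |ν (D + 2)| * |ρ| * S = |ν (D + 2)| * S * |ρ| := by ring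
          _ ≤ r2 * (1 / 2 ^ e) := this
      nlinarith [abs_nonneg ρ, abs_nonneg (ν (D + 2))]
    have h5 : (0 : ℝ) ≤ |(ν (D + 1) - p1 * bR ν p0 p1 D) + ν (D + 2) * ρ| := abs_nonneg _
    calc |δ| * S * (|(p0 : ℝ)| - |(p1 : ℝ)| / 2 ^ e)
        = |δ| * (|(p0 : ℝ)| - |(p1 : ℝ)| / 2 ^ e) * S := by ring
      _ ≤ |δ| * |(p0 : ℝ) + p1 * ρ| * S := mul_le_mul_of_nonneg_right h1 hS0
      _ = |ρ| ^ (D + 1) * (|(ν (D + 1) - p1 * bR ν p0 p1 D) + ν (D + 2) * ρ| * S) := by rw [h2]; ring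
      _ ≤ (1 / 2 ^ e) ^ (D + 1) * (r1 + r2 * (1 / 2 ^ e)) :=
          mul_le_mul h3 h4 (by positivity) (by positivity)
      _ = r1 * (1 / 2 ^ e) ^ (D + 1) + r2 * (1 / 2 ^ e) ^ (D + 2) := by ring
  -- integer rounding of the numerator
  set rn : ℤ := r1 / (2 ^ (e * (D + 1)) : ℤ) + r2 / (2 ^ (e * (D + 2)) : ℤ) + 2 with hrn
  have hrnR : r1 * (1 / 2 ^ e : ℝ) ^ (D + 1) + r2 * (1 / 2 ^ e : ℝ) ^ (D + 2) ≤ rn := by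
    have g1 := real_div_le_ediv_add_one r1 (d := 2 ^ (e * (D + 1))) (by positivity)
    have g2 := real_div_le_ediv_add_one r2 (d := 2 ^ (e * (D + 2))) (by positivity)
    push_cast at g1 g2
    have f1 : (r1 : ℝ) * (1 / 2 ^ e : ℝ) ^ (D + 1) = (r1 : ℝ) / (2 : ℝ) ^ (e * (D + 1)) := by
      rw [pow_mul]; ring
    have f2 : (r2 : ℝ) * (1 / 2 ^ e : ℝ) ^ (D + 2) = (r2 : ℝ) / (2 : ℝ) ^ (e * (D + 2)) := by
      rw [pow_mul]; ring
    rw [f1, f2, hrn]; push_cast; linarith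
  -- |δ|·S ≤ ⌈rn/m⌉
  set m : ℚ := |p0| - |p1| / (2 ^ e : ℚ) with hmdef
  have hmR' : ((m : ℚ) : ℝ) = |(p0 : ℝ)| - |(p1 : ℝ)| / 2 ^ e := by
    simp only [hmdef]; push_cast; ring
  have hδ : |δ| * S ≤ ((⌈(rn : ℚ) / m⌉ : ℤ) : ℝ) := by
    have hmpos : (0 : ℝ) < ((m : ℚ) : ℝ) := by rw [hmR']; exact hmR
    have h1 : |δ| * S ≤ (rn : ℝ) / ((m : ℚ) : ℝ) := by
      rw [le_div_iff₀ hmpos, hmR']; exact hkey.trans hrnR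
    have h2 : (rn : ℝ) / ((m : ℚ) : ℝ) ≤ ((⌈(rn : ℚ) / m⌉ : ℤ) : ℝ) := by
      have := Int.le_ceil ((rn : ℚ) / m)
      have h3 : (((rn : ℚ) / m : ℚ) : ℝ) ≤ ((⌈(rn : ℚ) / m⌉ : ℤ) : ℝ) := by exact_mod_cast this
      simpa using h3
    exact h1.trans h2
  -- assemble
  have hPB : PMem S ((List.range (D + 1)).map (bR ν p0 p1)) (bList num p0 p1 D).reverse := by
    rw [reverse_bList]; exact pmem_map_range (D + 1) (mem_bI hν p0 p1)
  obtain ⟨bs, hbs, ebs⟩ := exists_widen0 hPB hδ ρ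
  refine ⟨bs, ?_, ?_⟩
  · exact hbs
  · rw [ebs, evalR_map_range, ← hB, hδdef]; ring

end HRTMI

end Summit.CriticalPhenomena.Ising3D
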